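import Literature.MathematicalPhysics.KineticTheory.DiPernaLionsExtractionHolds
import Literature.MathematicalPhysics.KineticTheory.DiPernaLionsMildLimitProofs
import Literature.MathematicalPhysics.KineticTheory.DiPernaLionsSchemeHolds
import Literature.MathematicalPhysics.KineticTheory.DiPernaLionsGainLeLoss
import Literature.MathematicalPhysics.KineticTheory.DiPernaLionsLimitEntropyAssembly
import Literature.MathematicalPhysics.KineticTheory.VelocityAveragingProofs
import Literature.MathematicalPhysics.KineticTheory.DiPernaLionsTruncatedProblemProofs
import HarnessLib

/-!
# DiPerna–Lions weak stability: reduction to the three remaining named facts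

Topic: MathematicalPhysics / KineticTheory. The weak stability half (B)
`Literature.MathematicalPhysics.KineticTheory.diPernaLions_weakStability` of the DiPerna–Lions
theorem (DiPerna–Lions, Ann. of Math. 130 (1989), Theorem p. 322, stability part; printed proof:
Cercignani–Illner–Pulvirenti 1994 §5.3 Steps 8–14, pp. 147–160) was decomposed in
`Literature.MathematicalPhysics.KineticTheory.DiPernaLionsLimit` into (B1) extraction, (S14) the
limit is a mild solution, (D5) mild + integrability ⇒ renormalised, (B3) the entropy inequality of
the limit (proved assembly `diPernaLions_weakStability_of`), and (S14) in turn
(`Literature.MathematicalPhysics.KineticTheory.DiPernaLionsMildLimitProofs`) into (Lb) the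
collision-frequency bound, (E49) `Q± ≤ 2Q∓ + E` and (L12) the exponential form of CIP Lemma 5.3.12
(proved assembly `diPernaLions_limit_isAEMildSolution_of'`, with (Lb) discharged).

With the discharges already in the tree — (B1) `diPernaLions_extraction_holds` (CIP Steps 8–10,
Dunford–Pettis), (D5) `renormalisedIdentity_of_isAEMildSolution_holds` (CIP Lemma 5.3.4 (ii),
Appendix 5.A) and (Lb) `diPernaLions_limit_collisionFrequency_bound_holds` — (B) is reduced here
to exactly the three named facts that remain open on its spine, all three resting on the
velocity-averaging lemma (CIP Lemmas 5.3.8–5.3.11; `velocityAverage_relativelyCompact_L1`):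

* (E49) `diPernaLions_limit_gain_le_loss` (CIP 1994 (3.46)–(3.49), pp. 159–160);
* (L12) `diPernaLions_limit_expDuhamel` (CIP 1994 Lemma 5.3.12, (3.37) = (3.44), pp. 157–159);
* (B3) `diPernaLions_limit_entropyInequality` (DiPerna–Lions 1991; Lions 1993 Thm III.4 with (E);
  CIP 1994 Step 14, last display p. 160).

Everything in this file is proved; theorems only; no named fact is introduced. The discharge
`diPernaLions_weakStability_holds` is `diPernaLions_weakStability_of_facts` applied to the three
discharges `…_holds` of (E49), (L12), (B3) once they land.

Second layer (2026-08-15): (E49) and (B3) have meanwhile been proved granted the velocity-averaging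
lemma CIP 5.3.9 (`diPernaLions_limit_gain_le_loss_of_velocityAverage` in
`Literature.MathematicalPhysics.KineticTheory.DiPernaLionsGainLeLoss`, and
`diPernaLions_limit_entropyInequality_of_velocityAveraging` in
`Literature.MathematicalPhysics.KineticTheory.DiPernaLionsLimitEntropyAssembly`), so (B) — and,
with (A1), the DiPerna–Lions theorem — is further reduced to exactly two named facts: the
velocity-averaging lemma `velocityAverage_relativelyCompact_L1` (CIP Lemma 5.3.9) and (L12)
`diPernaLions_limit_expDuhamel` (CIP Lemma 5.3.12):
`diPernaLions_weakStability_of_velocityAverage_expDuhamel`, `diperna_lions_of_velocityAverage_expDuhamel`.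

Third layer (2026-08-15): the velocity-averaging lemma CIP 5.3.9 is now proved
(`velocityAverage_relativelyCompact_L1_holds` in
`Literature.MathematicalPhysics.KineticTheory.VelocityAveragingProofs`), and so is the global
solvability of the truncated problems CIP Lemma 5.3.6 (`truncatedProblem_globalExistence_holds` in
`Literature.MathematicalPhysics.KineticTheory.DiPernaLionsTruncatedProblemProofs`). Hence (B), and
the DiPerna–Lions theorem `diperna_lions` itself, are reduced to the single named fact (L12)
`diPernaLions_limit_expDuhamel` (CIP Lemma 5.3.12), every other input being discharged:
`diPernaLions_weakStability_of_expDuhamel`, `diperna_lions_of_expDuhamel`. The discharge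
`diPernaLions_weakStability_holds` is `diPernaLions_weakStability_of_expDuhamel` applied to
`diPernaLions_limit_expDuhamel_holds` once (L12) lands (its two printed halves are the hypotheses of
the proved conditional assembly `diPernaLions_limit_expDuhamel_of` of
`Literature.MathematicalPhysics.KineticTheory.DiPernaLionsExpDuhamel`).

## References

* R. J. DiPerna, P.-L. Lions, *On the Cauchy problem for Boltzmann equations: global existence and
  weak stability*, Ann. of Math. 130 (1989) 321–366 (Theorem p. 322).
* C. Cercignani, R. Illner, M. Pulvirenti, *The Mathematical Theory of Dilute Gases*, Springer
  (1994), §5.3 Thm 5.3.5 (pp. 144–145; proof = Steps 6–14, pp. 145–160).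
* P.-L. Lions, *Global solutions of kinetic models and related problems*, in: Nonequilibrium
  Problems in Many-Particle Systems, LNM 1551 (1993), Thm III.4 and Rem. III.8 (p. 57).
-/

namespace Literature.MathematicalPhysics.KineticTheory

universe u

/-- **Reduction of the weak stability theorem (B) to (E49), (L12), (B3)** (DiPerna–Lions 1989,
Theorem p. 322, stability part; CIP 1994 §5.3 Steps 8–14): granted the control of the gain by the
loss term for the weak limit (E49, CIP (3.46)–(3.49)), the exponential form of the weak limit
(L12, CIP Lemma 5.3.12) and the entropy inequality of the weak limit (B3, DiPerna–Lions 1991 /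
Lions 1993 Thm III.4), every DiPerna–Lions approximating sequence has a subsequence converging
weakly, slice by slice, to a renormalised solution with the stated bounds
(`diPernaLions_weakStability`). Proof: `diPernaLions_weakStability_of` with the proved discharges
of (B1) extraction (`diPernaLions_extraction_holds`), (D5) Lemma 5.3.4 (ii)
(`renormalisedIdentity_of_isAEMildSolution_holds`) and (S14) from (Lb)+(E49)+(L12)
(`diPernaLions_limit_isAEMildSolution_of'`). [cite: DiPernaLionsAnnals1989, Theorem p. 322 (stability part)]
[cite: CIPDiluteGases1994, §5.3 Steps 8–14 (pp. 147–160)] -/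
theorem diPernaLions_weakStability_of_facts (hE : diPernaLions_limit_gain_le_loss.{u})
    (hL12 : diPernaLions_limit_expDuhamel.{u}) (h3 : diPernaLions_limit_entropyInequality.{u}) :
    diPernaLions_weakStability.{u} :=
  diPernaLions_weakStability_of diPernaLions_extraction_holds
    (diPernaLions_limit_isAEMildSolution_of' hE hL12) renormalisedIdentity_of_isAEMildSolution_holds
    h3

/-- **The DiPerna–Lions theorem from the four remaining named facts** (DiPerna–Lions 1989 Theorem
p. 322; CIP 1994 Thm 5.3.5): with the approximating scheme reduced to the global solvability of
the truncated problems (`diPernaLions_approximatingScheme_of_truncatedProblem`, CIP Lemma 5.3.6)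
and weak stability reduced to (E49), (L12), (B3) (`diPernaLions_weakStability_of_facts`), the
global existence theorem `diperna_lions` follows from these four facts by the proved assembly
`diperna_lions_of_approximatingScheme_of_weakStability`. [cite: CIPDiluteGases1994, §5.3 Thm 5.3.5 (pp. 144–145)]
[cite: DiPernaLionsAnnals1989, Theorem p. 322] -/
theorem diperna_lions_of_facts {E : Type u} [NormedAddCommGroup E] [InnerProductSpace ℝ E]
    [FiniteDimensional ℝ E] [MeasurableSpace E] [BorelSpace E]
    (hA1 : truncatedProblem_globalExistence.{u}) (hE : diPernaLions_limit_gain_le_loss.{u})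
    (hL12 : diPernaLions_limit_expDuhamel.{u}) (h3 : diPernaLions_limit_entropyInequality.{u}) :
    diperna_lions (E := E) :=
  diperna_lions_of_approximatingScheme_of_weakStability
    (diPernaLions_approximatingScheme_of_truncatedProblem hA1)
    (diPernaLions_weakStability_of_facts hE hL12 h3)

/-- **Reduction of the weak stability theorem (B) to velocity averaging and (L12)** (DiPerna–Lions
1989, Theorem p. 322, stability part; CIP 1994 §5.3 Steps 8–14): granted the `L¹` compactness of
velocity averages (CIP Lemma 5.3.9, `velocityAverage_relativelyCompact_L1`) and the exponential
form of the weak limit (L12, CIP Lemma 5.3.12, `diPernaLions_limit_expDuhamel`), weak stability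
(`diPernaLions_weakStability`) holds. Proof: `diPernaLions_weakStability_of_facts` with (E49)
from Lemma 5.3.9 (`diPernaLions_limit_gain_le_loss_of_velocityAverage`, CIP Step 14
(3.46)–(3.49) and p. 160) and (B3) from Lemma 5.3.9
(`diPernaLions_limit_entropyInequality_of_velocityAveraging`, CIP Step 14 p. 160 / Lions 1993
Thm III.4 (E)). [cite: DiPernaLionsAnnals1989, Theorem p. 322 (stability part)]
[cite: CIPDiluteGases1994, §5.3 Steps 8–14 (pp. 147–160)] -/
theorem diPernaLions_weakStability_of_velocityAverage_expDuhamel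
    (h9 : velocityAverage_relativelyCompact_L1.{u}) (hL12 : diPernaLions_limit_expDuhamel.{u}) :
    diPernaLions_weakStability.{u} :=
  diPernaLions_weakStability_of_facts (diPernaLions_limit_gain_le_loss_of_velocityAverage h9) hL12
    (diPernaLions_limit_entropyInequality_of_velocityAveraging h9)

/-- **The DiPerna–Lions theorem from three named facts** (DiPerna–Lions 1989 Theorem p. 322; CIP
1994 Thm 5.3.5): global solvability of the truncated problems (A1,
`truncatedProblem_globalExistence`, CIP Lemma 5.3.6), the velocity-averaging lemma (CIP Lemma
5.3.9, `velocityAverage_relativelyCompact_L1`) and the exponential form of the weak limit (L12, CIP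
Lemma 5.3.12, `diPernaLions_limit_expDuhamel`) together give `diperna_lions`, by
`diperna_lions_of_facts` and the two assemblies granted Lemma 5.3.9.
[cite: CIPDiluteGases1994, §5.3 Thm 5.3.5 (pp. 144–145)] [cite: DiPernaLionsAnnals1989, Theorem p. 322] -/
theorem diperna_lions_of_velocityAverage_expDuhamel {E : Type u} [NormedAddCommGroup E]
    [InnerProductSpace ℝ E] [FiniteDimensional ℝ E] [MeasurableSpace E] [BorelSpace E]
    (hA1 : truncatedProblem_globalExistence.{u}) (h9 : velocityAverage_relativelyCompact_L1.{u})
    (hL12 : diPernaLions_limit_expDuhamel.{u}) : diperna_lions (E := E) :=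
  diperna_lions_of_facts hA1 (diPernaLions_limit_gain_le_loss_of_velocityAverage h9) hL12
    (diPernaLions_limit_entropyInequality_of_velocityAveraging h9)

/-- **Reduction of the weak stability theorem (B) to (L12) alone** (DiPerna–Lions 1989, Theorem
p. 322, stability part; CIP 1994 §5.3 Steps 8–14): granted only the exponential form of the weak
limit (L12, CIP Lemma 5.3.12, `diPernaLions_limit_expDuhamel`), weak stability
(`diPernaLions_weakStability`) holds — every other ingredient of CIP Steps 8–14 is proved in the
tree: extraction (B1, Steps 8–10), the velocity-averaging lemma 5.3.9
(`velocityAverage_relativelyCompact_L1_holds`) and with it (E49) `Q± ≤ 2Q∓ + E` (Step 14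
(3.46)–(3.49)) and the entropy inequality (B3, Step 14 p. 160), the collision-frequency bound (Lb)
and Lemma 5.3.4 (ii) (D5). Proof: `diPernaLions_weakStability_of_velocityAverage_expDuhamel` fed
with `velocityAverage_relativelyCompact_L1_holds`. [cite: DiPernaLionsAnnals1989, Theorem p. 322 (stability part)]
[cite: CIPDiluteGases1994, §5.3 Steps 8–14 (pp. 147–160), Lemma 5.3.12 (p. 157)] -/
theorem diPernaLions_weakStability_of_expDuhamel (hL12 : diPernaLions_limit_expDuhamel.{u}) :
    diPernaLions_weakStability.{u} :=
  diPernaLions_weakStability_of_velocityAverage_expDuhamel velocityAverage_relativelyCompact_L1_holds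
    hL12

/-- **The DiPerna–Lions theorem from (L12) alone** (DiPerna–Lions 1989 Theorem p. 322; CIP 1994
Thm 5.3.5, proof = Steps 6–14): with the truncated problems globally solvable (CIP Lemma 5.3.6,
`truncatedProblem_globalExistence_holds`) and the velocity-averaging lemma proved (CIP Lemma 5.3.9,
`velocityAverage_relativelyCompact_L1_holds`), the global existence theorem `diperna_lions` follows
from the exponential form of the weak limit (L12, CIP Lemma 5.3.12) by
`diperna_lions_of_velocityAverage_expDuhamel`. [cite: CIPDiluteGases1994, §5.3 Thm 5.3.5 (pp. 144–145)]
[cite: DiPernaLionsAnnals1989, Theorem p. 322] -/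
theorem diperna_lions_of_expDuhamel {E : Type u} [NormedAddCommGroup E] [InnerProductSpace ℝ E]
    [FiniteDimensional ℝ E] [MeasurableSpace E] [BorelSpace E]
    (hL12 : diPernaLions_limit_expDuhamel.{u}) : diperna_lions (E := E) :=
  diperna_lions_of_velocityAverage_expDuhamel truncatedProblem_globalExistence_holds
    velocityAverage_relativelyCompact_L1_holds hL12

end Literature.MathematicalPhysics.KineticTheory
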